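import Mathlib
import HarnessLib
import Literature.MathematicalPhysics.StatisticalMechanics.LinearisedMapABKMContraction
import Literature.MathematicalPhysics.StatisticalMechanics.LinearisedMapOpB
import Literature.MathematicalPhysics.StatisticalMechanics.FluctuationSmooth
import Literature.MathematicalPhysics.StatisticalMechanics.ActivitySpace
import Literature.MathematicalPhysics.StatisticalMechanics.TorusBlocks

/-!
# The operator `B_k = −Π₂ R_{k+1}(·)(B₀)` for the concrete torus data: Lemma 10.6 with the
# [ABKM19] parameters, and `B_k` as an additive map on the admissible activities

For the concrete parameters `P = abkmNormParams …` (gauge weights `𝔥_k = fieldWt h L d k`,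
`R_k = L^k`, radii `starRad`, weight tower `abkmWeightData` satisfying `AbkmWeightBounds`) and the
step data `D` of scale `k` (`s = L^k`, kernel `𝒞_{k+1}`, reference block `B_{x₀}`, base point the
corner of `B_{x₀}*`):

* `weightSectionDominated_abkm` — the weight `w_k^X` is dominated along the section of any gauge for
  `μ_{k+1} = stepMeasure 𝒞_{k+1}` (the common core of `integrationProperty_abkm`, `contDiff_fluct_abkm`);
* `abkm_box_lt`, `abkm_box_room`, `abkm_box_C0` — the no-wrap / room / size conditions of the box
  `B₀*` for `L ≥ 2^{d+3} + 16R`, `k + 1 ≤ N`, `p ≤ R`;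
* **`hamNorm_opB_abkm_le`** — Lemma 10.6 for the torus data:
  `‖B_k K‖_{k+1,0} ≤ L^d C_{8.7} A_𝒫 A^{−1} C` for `‖K‖_k^{(A)} ≤ C`, `K` local and `C^{r₀}`
  (`C_{8.7} = pi2BoundConst d (2R+2+⌊d/2⌋+1)`);
* `fluct_add_of_mem`, `Pi2_add_of_contDiff`, **`opBHom`** — `B_k` is additive on `activitySpace P k`
  (integrability from the norm bound, differentiability of `R_{k+1}K(B₀)` from `FluctuationSmooth`),
  bundled as `activitySpace P k →+ RelevantHamiltonian ℂ d`; `opBHom_apply`.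

Everything is proved; no named fact.

## References
* S. Adams, S. Buchholz, R. Kotecký, S. Müller, arXiv:1910.13564, Lemma 10.6, Lemma 8.4, Lemma 8.7,
  Theorem 6.8 (`B_k`) [AdamsBuchholzKoteckyMuller2019].
-/

noncomputable section

namespace Literature.MathematicalPhysics.StatisticalMechanics.GradientRG

open scoped BigOperators Classical MatrixOrder
open Finset Matrix MeasureTheory
open Literature.MathematicalPhysics.StatisticalMechanics.GradientFRD (cExt fourierCoeff mulMat)
open Literature.MathematicalPhysics.StatisticalMechanics.TorusPolymer
  (IsPolymer numBlocks blockOf thicken boxCorner isPolymer_blockOf card_blockOf)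
open Literature.Barriers.CriticalPhenomena.LongRangePhi4.Polymer (IsConn)
open Literature.MathematicalPhysics.QuantumFieldTheory

variable {d M : ℕ} [NeZero M]

/-! ## Section domination of the torus weights -/

/-- **`w_k^X` is dominated along the section of any gauge `T` for `μ_{k+1}`** (from `Dominated` with
the multiplier margin `θ̄`: `(1 + θ̄/2)A_k^X` is subcritical for `𝒞_{k+1}`).
[cite: AdamsBuchholzKoteckyMuller2019, Lemma 8.4 (proof)] -/
theorem weightSectionDominated_abkm {L N Mord R n : ℕ} {θbar lam μ δ₁ δ₀ A𝒫 : ℝ}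
    {𝒞 : ℕ → (Fin d → ZMod M) → ℝ} (hθbar : 0 < θbar) (hlam : 0 < lam)
    (hB : AbkmWeightBounds L N Mord R n θbar lam μ δ₁ δ₀ A𝒫 𝒞
      (abkmWeightData L N Mord R θbar (schedDelta δ₀ δ₁ N) 𝒞))
    {k : ℕ} (hk : k + 1 ≤ N + 1) (X : Finset (Fin d → ZMod M))
    {V : Type*} [NormedAddCommGroup V] [NormedSpace ℝ V] (T : ((Fin d → ZMod M) → ℝ) →ₗ[ℝ] V) :
    WeightSectionDominated T ((abkmWeightData L N Mord R θbar (schedDelta δ₀ δ₁ N) 𝒞).weight k X)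
      (stepMeasure (𝒞 (k + 1))) := by
  set W := abkmWeightData L N Mord R θbar (schedDelta δ₀ δ₁ N) 𝒞 with hW
  have heven_all : ∀ j ∈ Finset.Icc 1 (N + 1), ∀ x, 𝒞 j (-x) = 𝒞 j x :=
    fun j hj => (hB.zero_sum_even j hj).2
  have heven : ∀ x, 𝒞 (k + 1) (-x) = 𝒞 (k + 1) x := heven_all (k + 1) (Finset.mem_Icc.2 ⟨by omega, hk⟩)
  have hf_even := fun κ j => GradientFRD.cExt_fourierCoeff_neg (N := N) heven_all κ j
  have hnn := hB.multipliers_nonneg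
  have hD := hB.dominated
  have hθlo : θbar ≤ thetaSeq θbar μ δ₁ N k := (hB.theta_mem k).1
  have hCeq := circulant_eq_mulMat_cExt hk heven (N := N)
  have hsub : ((1 : Matrix _ _ ℝ) - CFC.sqrt (Matrix.circulant (𝒞 (k + 1))) *
      ((1 + θbar / 2) • W.form k X) * CFC.sqrt (Matrix.circulant (𝒞 (k + 1)))).PosDef := by
    rw [hCeq]
    exact posDef_one_sub_smul_form W (c := fun j κ => cExt N (fun j => fourierCoeff (𝒞 j) κ) j)
      hD hθbar hθlo hlam.le (by linarith) (by linarith)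
      (fun k κ => derivMul_neg _ k _ κ) (fun κ => derivMul_nonneg (Nat.cast_nonneg L) k _ κ)
      (fun κ => hf_even κ (k + 1)) (fun κ => hnn (k + 1) κ)
      (fun k κ => tailMul_neg_of_cExt hf_even k κ) (fun κ => tailMul_succ N _ k κ)
      (fun κ => tailMul_nonneg (fun κ j => hnn j κ) (k + 1) κ) X
  have hwe : W.weight k X = expWeight (W.form k X) :=
    funext fun φ => WeightData.weight_eq_expWeight k X φ
  rw [hwe]
  exact weightSectionDominated_expWeight T (C := Matrix.circulant (𝒞 (k + 1)))
    (WeightData.form_posSemidef hD k X) (η := θbar / 2) (by linarith) hsub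

/-! ## The box `B₀*` for the concrete parameters -/

/-- No wrap-around of the box `B₀*`: `4(⌊(L^k−1)/2⌋ + r_k) < L^N` for `k + 1 ≤ N`.
[cite: AdamsBuchholzKoteckyMuller2019, Lemma 8.9 (the box)] -/
theorem abkm_box_lt {L N R p : ℕ} (hL : 2 ^ (d + 3) + 16 * R ≤ L) (hpR : p ≤ R) {k : ℕ}
    (hkN : k + 1 ≤ N) :
    4 * ((L ^ k - 1) / 2 + starRad R L d k) < L ^ N ∧
      (2 * ((L ^ k - 1) / 2 + starRad R L d k) + p) * 2 < L ^ N := by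
  have h8 : 8 ≤ 2 ^ (d + 3) := by
    calc 8 = 2 ^ 3 := by norm_num
      _ ≤ 2 ^ (d + 3) := Nat.pow_le_pow_right (by norm_num) (by omega)
  have hL1 : 1 ≤ L := by omega
  have hbox := two_mul_box_add_le (d := d) hL hpR k
  have hLN : L ^ (k + 1) ≤ L ^ N := Nat.pow_le_pow_right hL1 hkN
  have hLk1 : 1 ≤ L ^ k := Nat.one_le_pow _ _ hL1
  have hdiv : 2 * ((L ^ k - 1) / 2) + 1 ≤ L ^ k := by
    have := Nat.mul_div_le (L ^ k - 1) 2; omega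
  constructor <;> omega

/-- The size of the box plus the Taylor order: `ρ' + ⌊d/2⌋ + 1 ≤ (2R + 2 + ⌊d/2⌋ + 1) L^k`.
[cite: AdamsBuchholzKoteckyMuller2019, Lemma 8.7 (the constant C₀)] -/
theorem abkm_box_C0 {L R : ℕ} (hL : 2 ^ (d + 3) + 16 * R ≤ L) (k : ℕ) :
    ((2 * ((L ^ k - 1) / 2 + starRad R L d k) : ℕ) : ℝ) + (d / 2 + 1 : ℕ) ≤
      (((2 * R + 2 : ℕ) : ℝ) + ((d / 2 + 1 : ℕ) : ℝ)) * (L : ℝ) ^ k := by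
  have h8 : 8 ≤ 2 ^ (d + 3) := by
    calc 8 = 2 ^ 3 := by norm_num
      _ ≤ 2 ^ (d + 3) := Nat.pow_le_pow_right (by norm_num) (by omega)
  have hL1 : (1 : ℝ) ≤ L := by exact_mod_cast (show 1 ≤ L by omega)
  have hside := boxSide_le (d := d) hL k
  have hρ : ((2 * ((L ^ k - 1) / 2 + starRad R L d k) : ℕ) : ℝ) ≤ ((2 * R + 2 : ℕ) : ℝ) * (L : ℝ) ^ k := by
    exact_mod_cast hside
  have hLk : (1 : ℝ) ≤ (L : ℝ) ^ k := one_le_pow₀ hL1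
  have h1 : ((d / 2 + 1 : ℕ) : ℝ) ≤ ((d / 2 + 1 : ℕ) : ℝ) * (L : ℝ) ^ k :=
    le_mul_of_one_le_right (Nat.cast_nonneg _) hLk
  calc ((2 * ((L ^ k - 1) / 2 + starRad R L d k) : ℕ) : ℝ) + (d / 2 + 1 : ℕ)
      ≤ ((2 * R + 2 : ℕ) : ℝ) * (L : ℝ) ^ k + ((d / 2 + 1 : ℕ) : ℝ) * (L : ℝ) ^ k := add_le_add hρ h1
    _ = (((2 * R + 2 : ℕ) : ℝ) + ((d / 2 + 1 : ℕ) : ℝ)) * (L : ℝ) ^ k := by ring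

/-! ## Lemma 10.6 for the concrete data -/

/-- **[ABKM19] Lemma 10.6 for the torus data**: for `d ≥ 3`, `L` odd, `L ≥ 2^{d+3} + 16R`, `M = L^N`,
`k + 1 ≤ N`, `⌊d/2⌋ + 2 ≤ p`, `p + d ≤ M_ord ≤ R`, `r₀ ≥ 3`, `h > 0`, a weight tower with the
conclusions of Theorem 7.1 (integration constant `A_𝒫`), `A ≥ 1`, step data of scale `k` (kernel
`𝒞_{k+1}`, reference block `B_{x₀}`, base point the corner of `B_{x₀}*`), and a local `C^{r₀}` activity
with `‖K‖_k^{(A)} ≤ C`: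
`‖B_k K‖_{k+1,0} ≤ L^d · C_{8.7} · C A_𝒫 A^{−1}` with the coefficient norm at the scale-`(k+1)` weights
`(𝔥_{k+1}, L^{k+1}, L^{d(k+1)})`. [cite: AdamsBuchholzKoteckyMuller2019, Lemma 10.6] -/
theorem hamNorm_opB_abkm_le {L N Mord R n p r₀ : ℕ} {θbar lam μ δ₁ δ₀ A𝒫 h A : ℝ}
    {𝒞 : ℕ → (Fin d → ZMod M) → ℝ} (hd : 3 ≤ d) (hLodd : Odd L) (hL : 2 ^ (d + 3) + 16 * R ≤ L)
    (hM : M = L ^ N) {k : ℕ} (hkN : k + 1 ≤ N) (hpM : p + d ≤ Mord) (hMR : Mord ≤ R)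
    (hr₀ : 3 ≤ r₀) (hθbar : 0 < θbar) (hlam : 0 < lam)
    (hB : AbkmWeightBounds L N Mord R n θbar lam μ δ₁ δ₀ A𝒫 𝒞
      (abkmWeightData L N Mord R θbar (schedDelta δ₀ δ₁ N) 𝒞))
    (hh : 0 < h) (hA : 1 ≤ A)
    (D : StepData d M) (hD𝒞 : D.𝒞 = 𝒞 (k + 1)) {x₀ : Fin d → ZMod M} (hB₀ : D.B₀ = blockOf (L ^ k) x₀)
    (hc₀ : D.c₀ = boxCorner (L ^ k) (starRad R L d k) x₀)
    {K : Finset (Fin d → ZMod M) → ((Fin d → ZMod M) → ℝ) → ℂ} {C : ℝ} (hC : 0 ≤ C)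
    (hK : WeakNormLE (abkmNormParams L N Mord R p r₀ h θbar A (schedDelta δ₀ δ₁ N) 𝒞) k K C)
    (hKd : ∀ X, ContDiff ℝ r₀ (K X))
    (hKloc : ∀ X, IsPolymer (L ^ k) X → IsConn X →
      IsGaugeLocal ((abkmNormParams L N Mord R p r₀ h θbar A (schedDelta δ₀ δ₁ N) 𝒞).gauge k X) (K X)) :
    hamNorm (fieldWt h L d (k + 1)) ((L : ℝ) ^ (k + 1)) (L ^ (d * (k + 1))) (opB D K) ≤
      (L : ℝ) ^ d * (pi2BoundConst d (((2 * R + 2 : ℕ) : ℝ) + ((d / 2 + 1 : ℕ) : ℝ)) *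
        (C * A𝒫 * A⁻¹)) := by
  set P := abkmNormParams L N Mord R p r₀ h θbar A (schedDelta δ₀ δ₁ N) 𝒞 with hP
  have h8 : 8 ≤ 2 ^ (d + 3) := by
    calc 8 = 2 ^ 3 := by norm_num
      _ ≤ 2 ^ (d + 3) := Nat.pow_le_pow_right (by norm_num) (by omega)
  have hL4 : 4 ≤ L := by omega
  have hL0 : (0 : ℝ) < L := by exact_mod_cast hLodd.pos
  have hpR : p ≤ R := by omega
  -- the torus at scale `k`
  obtain ⟨t, ht⟩ : ∃ t, N = k + t := ⟨N - k, by omega⟩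
  have hMt0 : M = L ^ k * L ^ t := by rw [← pow_add, ← ht]; exact hM
  have hMt : M = P.L ^ k * L ^ t := hMt0
  have htodd : Odd (L ^ t) := hLodd.pow
  -- weights of the two scales
  have h𝔥' : 0 < P.𝔥 (k + 1) := fieldWt_pos hh hL0 d (k + 1)
  have h𝔥k : 0 < P.𝔥 k := fieldWt_pos hh hL0 d k
  have hsucc : P.𝔥 (k + 1) = scaleRatio d L * P.𝔥 k := fieldWt_succ_nat hLodd.pos d k
  have h𝔥le : P.𝔥 (k + 1) ≤ P.𝔥 k := by
    rw [hsucc]; exact mul_le_of_le_one_left h𝔥k.le (scaleRatio_le_one hd hL4)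
  have hR : 0 < P.R k := by show (0 : ℝ) < (L : ℝ) ^ k; positivity
  have hRle : P.R k ≤ P.R (k + 1) := by
    show (L : ℝ) ^ k ≤ (L : ℝ) ^ (k + 1)
    exact pow_le_pow_right₀ (by exact_mod_cast hLodd.pos) (Nat.le_succ k)
  have hr₀' : 2 ≤ P.r₀ := by show 2 ≤ r₀; omega
  -- the box
  obtain ⟨hwrap0, hroom0⟩ := abkm_box_lt (d := d) hL hpR hkN
  have hwrap : 4 * ((P.L ^ k - 1) / 2 + P.rad k) < M := by
    show 4 * ((L ^ k - 1) / 2 + starRad R L d k) < M; rw [hM]; exact hwrap0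
  have hroom : ((2 * ((P.L ^ k - 1) / 2 + P.rad k) : ℕ) + (P.p : ℤ)) * 2 < M := by
    show ((2 * ((L ^ k - 1) / 2 + starRad R L d k) : ℕ) + (p : ℤ)) * 2 < (M : ℤ)
    rw [hM]; exact_mod_cast hroom0
  have hC₀ : (1 : ℝ) ≤ ((2 * R + 2 : ℕ) : ℝ) + ((d / 2 + 1 : ℕ) : ℝ) := by
    have : (1 : ℝ) ≤ ((2 * R + 2 : ℕ) : ℝ) := by exact_mod_cast (show 1 ≤ 2 * R + 2 by omega)
    linarith [(Nat.cast_nonneg (d / 2 + 1) : (0 : ℝ) ≤ _)]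
  have hρ0 : ((2 * ((P.L ^ k - 1) / 2 + P.rad k) : ℕ) : ℝ) + (d / 2 + 1 : ℕ) ≤
      (((2 * R + 2 : ℕ) : ℝ) + ((d / 2 + 1 : ℕ) : ℝ)) * P.R k := abkm_box_C0 (d := d) hL k
  -- integration property
  have hk1 : k + 1 ≤ N + 1 := by omega
  have hint : IntegrationProperty P k D.𝒞 A𝒫 := by
    rw [hD𝒞]; exact integrationProperty_abkm hθbar hlam hB hk1 p r₀ h A
  -- `B_k K` only sees `K(B₀)`; replace `K` by its restriction to connected `k`-polymers
  set K' : Finset (Fin d → ZMod M) → ((Fin d → ZMod M) → ℝ) → ℂ :=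
    fun X => if IsPolymer (L ^ k) X ∧ IsConn X then K X else 0 with hK'def
  have hMo : Odd M := by rw [hM]; exact hLodd.pow
  have hPB : IsPolymer (L ^ k) D.B₀ := by rw [hB₀]; exact isPolymer_blockOf _ x₀
  have hcB : IsConn D.B₀ := by rw [hB₀]; exact TorusPolymer.isConn_blockOf hMo hLodd.pow x₀
  have hK'B : K' D.B₀ = K D.B₀ := by simp only [hK'def, hPB, hcB, and_self, if_true]
  have hopB : opB D K = opB D K' := by unfold opB; rw [hK'B]
  have hK' : WeakNormLE P k K' C := fun X hX hc => by
    have : K' X = K X := by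
      show (if IsPolymer (L ^ k) X ∧ IsConn X then K X else 0) = K X
      exact if_pos ⟨hX, hc⟩
    rw [this]; exact hK X hX hc
  have hK'd : ∀ X, ContDiff ℝ P.r₀ (K' X) := fun X => by
    by_cases hX : IsPolymer (L ^ k) X ∧ IsConn X
    · simp only [hK'def, if_pos hX]; exact hKd X
    · simp only [hK'def, if_neg hX]; exact contDiff_const
  have hK'loc : ∀ X, IsPolymer (P.L ^ k) X → IsConn X → IsGaugeLocal (P.gauge k X) (K' X) :=
    fun X hX hc => by
      have : K' X = K X := by
        show (if IsPolymer (L ^ k) X ∧ IsConn X then K X else 0) = K X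
        exact if_pos ⟨hX, hc⟩
      rw [this]; exact hKloc X hX hc
  have hA0 : 0 < A := by linarith
  have hR'd : ∀ X, ContDiff ℝ P.r₀ (fluct D.𝒞 (K' X)) := fun X => by
    by_cases hX : IsPolymer (L ^ k) X ∧ IsConn X
    · rw [hD𝒞]
      exact contDiff_fluct_of_weakNormLE hθbar hlam hB hk1 hA0 hC hK' hK'd hK'loc hX.1 hX.2
    · have : K' X = 0 := by simp only [hK'def, if_neg hX]
      rw [this]
      have h0 : fluct D.𝒞 (0 : ((Fin d → ZMod M) → ℝ) → ℂ) = fun _ => 0 := by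
        funext φ; unfold fluct; simp
      rw [h0]; exact contDiff_const
  -- Lemma 10.6 (abstract) for `K'`
  have hmain := hamNorm_opB_le_succ P hMt hLodd htodd D hB₀ hc₀ h𝔥' h𝔥le hR hRle hr₀' hwrap hroom hC₀
    hρ0 hint hC hK' hK'd hK'loc hR'd hA
  -- bookkeeping: `L^d · |B₀| = L^{d(k+1)}`
  have hcard : D.B₀.card = L ^ (d * k) := by
    rw [hB₀, card_blockOf hMt0 hLodd.pow htodd x₀, ← pow_mul, mul_comm]
  have hn : P.L ^ d * D.B₀.card = L ^ (d * (k + 1)) := by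
    show L ^ d * D.B₀.card = L ^ (d * (k + 1))
    rw [hcard, ← pow_add]; congr 1; ring
  rw [hopB, ← hn]
  exact hmain

/-! ## `B_k` is additive on the admissible activities -/

/-- Additivity of the fluctuation integral under integrability.
[cite: AdamsBuchholzKoteckyMuller2019, Ch. 6.1 (6.9)] -/
theorem fluct_add_of_integrable {𝒞 : (Fin d → ZMod M) → ℝ} {F G : ((Fin d → ZMod M) → ℝ) → ℂ}
    (hF : ∀ φ, Integrable (fun ξ => F (φ + ξ)) (stepMeasure 𝒞))
    (hG : ∀ φ, Integrable (fun ξ => G (φ + ξ)) (stepMeasure 𝒞)) :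
    fluct 𝒞 (F + G) = fluct 𝒞 F + fluct 𝒞 G := by
  funext φ
  unfold fluct
  exact integral_comp_add_add φ (hF φ) (hG φ)

/-- `Π₂` is additive on `C²` functionals. [cite: AdamsBuchholzKoteckyMuller2019, Definition 8.6] -/
theorem Pi2_add_of_contDiff (c : Fin d → ZMod M) (B : Finset (Fin d → ZMod M))
    {F G : ((Fin d → ZMod M) → ℝ) → ℂ} (hF : ContDiff ℝ 2 F) (hG : ContDiff ℝ 2 G) :
    Pi2 c B (F + G) = Pi2 c B F + Pi2 c B G := by
  unfold Pi2
  rw [Pi.add_apply, fderiv_add (hF.differentiable (by norm_num) 0) (hG.differentiable (by norm_num) 0),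
    iteratedFDeriv_add_apply hF.contDiffAt hG.contDiffAt]
  exact Pi2Data_add c B _ _ _ _ _ _

/-- **`B_k : M(𝓟_k^c) → M_0(𝓑_{k+1})`, `B_k K = −Π₂ R_{k+1} K(B₀)`, as an additive map on the
admissible activities** of the concrete parameters (`r₀ ≥ 2`, `k + 1 ≤ N + 1`, kernel
`𝒞_{k+1}`, `B₀` a `k`-block): integrability of `K(B₀, φ + ·)` and differentiability of `R_{k+1}K(B₀)`
follow from the norm bound. [cite: AdamsBuchholzKoteckyMuller2019, Theorem 6.8 (the operator B_k)] -/
def opBHom {L N Mord R n p r₀ : ℕ} {θbar lam μ δ₁ δ₀ A𝒫 h A : ℝ} {𝒞 : ℕ → (Fin d → ZMod M) → ℝ}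
    (hθbar : 0 < θbar) (hlam : 0 < lam)
    (hB : AbkmWeightBounds L N Mord R n θbar lam μ δ₁ δ₀ A𝒫 𝒞
      (abkmWeightData L N Mord R θbar (schedDelta δ₀ δ₁ N) 𝒞))
    {k : ℕ} (hk : k + 1 ≤ N + 1) (hr₀ : 2 ≤ r₀) (hLodd : Odd L) (hM : M = L ^ N)
    (D : StepData d M) (hD𝒞 : D.𝒞 = 𝒞 (k + 1)) {x₀ : Fin d → ZMod M} (hB₀ : D.B₀ = blockOf (L ^ k) x₀) :
    activitySpace (abkmNormParams L N Mord R p r₀ h θbar A (schedDelta δ₀ δ₁ N) 𝒞) k →+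
      RelevantHamiltonian ℂ d :=
  AddMonoidHom.mk' (fun K => opB D (K : Finset (Fin d → ZMod M) → ((Fin d → ZMod M) → ℝ) → ℂ))
    (by
      intro K K'
      have hMo : Odd M := by rw [hM]; exact hLodd.pow
      have hPB : IsPolymer ((abkmNormParams L N Mord R p r₀ h θbar A (schedDelta δ₀ δ₁ N) 𝒞).L ^ k) D.B₀ := by rw [hB₀]; exact isPolymer_blockOf _ x₀
      have hcB : IsConn D.B₀ := by rw [hB₀]; exact TorusPolymer.isConn_blockOf hMo hLodd.pow x₀
      -- the norm bounds of the two activities at `B₀`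
      obtain ⟨C, hC⟩ := activitySpace.exists_weakNormLE K
      obtain ⟨C', hC'⟩ := activitySpace.exists_weakNormLE K'
      have hCn : 0 ≤ C * (abkmNormParams L N Mord R p r₀ h θbar A (schedDelta δ₀ δ₁ N) 𝒞).aFactor k D.B₀ := by
        have h1 := (hC D.B₀ hPB hcB) 0
        exact (mul_nonneg_iff_of_pos_right ((abkmNormParams L N Mord R p r₀ h θbar A (schedDelta δ₀ δ₁ N) 𝒞).W.weight_pos k D.B₀ 0)).1 ((tayNorm_nonneg _ _ _ _).trans h1)
      have hC'n : 0 ≤ C' * (abkmNormParams L N Mord R p r₀ h θbar A (schedDelta δ₀ δ₁ N) 𝒞).aFactor k D.B₀ := by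
        have h1 := (hC' D.B₀ hPB hcB) 0
        exact (mul_nonneg_iff_of_pos_right ((abkmNormParams L N Mord R p r₀ h θbar A (schedDelta δ₀ δ₁ N) 𝒞).W.weight_pos k D.B₀ 0)).1 ((tayNorm_nonneg _ _ _ _).trans h1)
      have hdom := weightSectionDominated_abkm hθbar hlam hB hk D.B₀ ((abkmNormParams L N Mord R p r₀ h θbar A (schedDelta δ₀ δ₁ N) 𝒞).gauge k D.B₀)
      have hiK : ∀ φ, Integrable (fun ξ => (K : (Finset (Fin d → ZMod M) → ((Fin d → ZMod M) → ℝ) → ℂ)) D.B₀ (φ + ξ)) (stepMeasure D.𝒞) :=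
        fun φ => by
          rw [hD𝒞]
          exact integrable_comp_add_of_tayNormLE (hC D.B₀ hPB hcB) hCn (activitySpace.contDiff K _)
            (activitySpace.isGaugeLocal K hPB hcB) hdom φ
      have hiK' : ∀ φ, Integrable (fun ξ => (K' : (Finset (Fin d → ZMod M) → ((Fin d → ZMod M) → ℝ) → ℂ)) D.B₀ (φ + ξ)) (stepMeasure D.𝒞) :=
        fun φ => by
          rw [hD𝒞]
          exact integrable_comp_add_of_tayNormLE (hC' D.B₀ hPB hcB) hC'n (activitySpace.contDiff K' _)
            (activitySpace.isGaugeLocal K' hPB hcB) hdom φ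
      have hdK : ContDiff ℝ 2 (fluct D.𝒞 ((K : (Finset (Fin d → ZMod M) → ((Fin d → ZMod M) → ℝ) → ℂ)) D.B₀)) := by
        rw [hD𝒞]
        exact (contDiff_fluct_abkm hθbar hlam hB hk D.B₀ ((abkmNormParams L N Mord R p r₀ h θbar A (schedDelta δ₀ δ₁ N) 𝒞).gauge k D.B₀) hCn (activitySpace.contDiff K _)
          (activitySpace.isGaugeLocal K hPB hcB) (hC D.B₀ hPB hcB)).of_le (by exact_mod_cast hr₀)
      have hdK' : ContDiff ℝ 2 (fluct D.𝒞 ((K' : (Finset (Fin d → ZMod M) → ((Fin d → ZMod M) → ℝ) → ℂ)) D.B₀)) := by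
        rw [hD𝒞]
        exact (contDiff_fluct_abkm hθbar hlam hB hk D.B₀ ((abkmNormParams L N Mord R p r₀ h θbar A (schedDelta δ₀ δ₁ N) 𝒞).gauge k D.B₀) hC'n (activitySpace.contDiff K' _)
          (activitySpace.isGaugeLocal K' hPB hcB) (hC' D.B₀ hPB hcB)).of_le (by exact_mod_cast hr₀)
      show opB D ((K + K' : activitySpace (abkmNormParams L N Mord R p r₀ h θbar A (schedDelta δ₀ δ₁ N) 𝒞) k) : (Finset (Fin d → ZMod M) → ((Fin d → ZMod M) → ℝ) → ℂ)) =
        opB D (K : (Finset (Fin d → ZMod M) → ((Fin d → ZMod M) → ℝ) → ℂ)) + opB D (K' : (Finset (Fin d → ZMod M) → ((Fin d → ZMod M) → ℝ) → ℂ))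
      rw [Submodule.coe_add]
      unfold opB
      rw [Pi.add_apply, fluct_add_of_integrable hiK hiK', Pi2_add_of_contDiff _ _ hdK hdK', neg_add])

/-- `opBHom` is `B_k`. [cite: AdamsBuchholzKoteckyMuller2019, Theorem 6.8 (the operator B_k)] -/
theorem opBHom_apply {L N Mord R n p r₀ : ℕ} {θbar lam μ δ₁ δ₀ A𝒫 h A : ℝ}
    {𝒞 : ℕ → (Fin d → ZMod M) → ℝ} (hθbar : 0 < θbar) (hlam : 0 < lam)
    (hB : AbkmWeightBounds L N Mord R n θbar lam μ δ₁ δ₀ A𝒫 𝒞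
      (abkmWeightData L N Mord R θbar (schedDelta δ₀ δ₁ N) 𝒞))
    {k : ℕ} (hk : k + 1 ≤ N + 1) (hr₀ : 2 ≤ r₀) (hLodd : Odd L) (hM : M = L ^ N)
    (D : StepData d M) (hD𝒞 : D.𝒞 = 𝒞 (k + 1)) {x₀ : Fin d → ZMod M} (hB₀ : D.B₀ = blockOf (L ^ k) x₀)
    (K : activitySpace (abkmNormParams L N Mord R p r₀ h θbar A (schedDelta δ₀ δ₁ N) 𝒞) k) :
    opBHom hθbar hlam hB hk hr₀ hLodd hM D hD𝒞 hB₀ K =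
      opB D (K : Finset (Fin d → ZMod M) → ((Fin d → ZMod M) → ℝ) → ℂ) := by
  simp only [opBHom, AddMonoidHom.mk'_apply]

end Literature.MathematicalPhysics.StatisticalMechanics.GradientRG

end
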